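import Mathlib
import Summits.ValiantsHypothesis.ValiantsHypothesis.Theorems.SummationBitsDepth3ThesisStubMidGrowth

/-!
# Crux `Depth3Thesis` (stmt-ValiantsHypothesis-5934), line `birth`: the flattenings are BLIND in the
high-degree window

Tightness datum for the one open stub `stub_highRegime` of `Cruxes/Depth3Thesis/Lines/birth.lean`
(rev 3). The landed stub `stub_flattening` says that an affine ΣΠΣ expression
`per_n = Σ_{i<r} Π_{j<D} ℓ_ij` forces `binom(n,k)² ≤ r · binom(D,k)` for every order `k`
(Nisan–Wigderson); the landed stubs `stub_binomialGrowth` / `stub_midGrowth` turn this into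
`r > (n+2)^(c⌊√n⌋+c)` for all `D ≤ n²/(4k₀)`, `k₀ = (c⌊√n⌋+c+1)(⌊log₂(n+2)⌋+1)`.

Here we prove the converse bookkeeping: once `D · (c⌊√n⌋+c) ≥ 3n²` (and `D ≥ 2n`, `n ≥ 2`), the
flattening inequality holds with `r = (n+2)^(c⌊√n⌋+c)` for EVERY order `k`:
`binom(n,k)² ≤ (n+2)^(c⌊√n⌋+c) · binom(D,k)`. So in the window of `stub_highRegime` (up to the factor
`12(⌊log₂(n+2)⌋+1)` between `n²/(4k₀)` and `3n²/(c⌊√n⌋+c)`) the method of partial derivatives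
cannot certify a single wire beyond the threshold — whatever closes the window must be a different,
degree-insensitive measure. Elementary: `k!·binom(n,k) ≤ n^k`, `k!·binom(D,k) ≥ (D+1-k)^k ≥ (D/2)^k`,
and `(2E)^k ≤ k!·binom(2E+k,k) ≤ k!·2^(2E+k)` (`E = c⌊√n⌋+c`), against `D·E ≥ 3n²`.

## Main statements
* `pow_le_factorial_mul_choose_add` — `m^k ≤ k! · binom(m+k,k)`.
* `flattening_blind` — the blindness inequality above.
-/

-- `Summit.ValiantsHypothesis.ValiantsHypothesis.…` is the tree's mandated single-conjunct layout.
set_option linter.dupNamespace false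

namespace Summit.ValiantsHypothesis.ValiantsHypothesis.Theorems.SummationBitsDepth3Thesis

/-- `m^k ≤ k! · binom(m+k, k)` (indeed `k!·binom(m+k,k) = (m+k)(m+k-1)⋯(m+1) ≥ (m+1)^k`). [folklore] -/
theorem pow_le_factorial_mul_choose_add (m k : ℕ) : m ^ k ≤ k.factorial * (m + k).choose k := by
  rw [← Nat.descFactorial_eq_factorial_mul_choose]
  calc m ^ k ≤ (m + k + 1 - k) ^ k := Nat.pow_le_pow_left (by omega) k
    _ ≤ (m + k).descFactorial k := Nat.pow_sub_le_descFactorial (m + k) k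

/-- `(2E)^k ≤ k! · 3^k · (n+2)^E` for `n ≥ 2`: the Taylor-coefficient bound `x^k/k! ≤ 4^x` at `x = 2E`,
via `(2E)^k ≤ k!·binom(2E+k,k) ≤ k!·2^(2E+k)`. [folklore] -/
theorem two_mul_pow_le (n E k : ℕ) (hn : 2 ≤ n) :
    (2 * E) ^ k ≤ k.factorial * 3 ^ k * (n + 2) ^ E := by
  calc (2 * E) ^ k ≤ k.factorial * (2 * E + k).choose k := pow_le_factorial_mul_choose_add _ _
    _ ≤ k.factorial * 2 ^ (2 * E + k) := Nat.mul_le_mul_left _ (Nat.choose_le_two_pow _ _)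
    _ = k.factorial * 2 ^ k * 4 ^ E := by
        rw [pow_add, pow_mul, show (2 : ℕ) ^ 2 = 4 by norm_num]; ring
    _ ≤ k.factorial * 3 ^ k * (n + 2) ^ E := by
        gcongr
        · norm_num
        · omega

/-- **The flattenings are blind in the window.** For `n ≥ 2`, `D ≥ 2n` and
`D · (c⌊√n⌋+c) ≥ 3n²`, the Nisan–Wigderson inequality `binom(n,k)² ≤ r · binom(D,k)` of
`stub_flattening` is satisfied by `r = (n+2)^(c⌊√n⌋+c)` at EVERY order `k`; hence no choice of `k`
lets the method of partial derivatives prove `r > (n+2)^(c⌊√n⌋+c)` there (tightness datum for the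
open stub `stub_highRegime` of crux `Depth3Thesis`). [folklore] -/
theorem flattening_blind :
    ∀ (n c D k : ℕ), 2 ≤ n → 2 * n ≤ D → 3 * n ^ 2 ≤ D * (c * Nat.sqrt n + c) →
      (n.choose k) ^ 2 ≤ (n + 2) ^ (c * Nat.sqrt n + c) * D.choose k := by
  intro n c D k hn hD hwin
  generalize hE : c * Nat.sqrt n + c = E at hwin ⊢
  rcases Nat.lt_or_ge n k with hnk | hkn
  · rw [Nat.choose_eq_zero_of_lt hnk]; simp
  -- `E ≥ 1` (else `3n² ≤ 0`)
  have hE1 : 1 ≤ E := by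
    rcases Nat.eq_zero_or_pos E with h | h
    · subst h; simp at hwin; omega
    · exact h
  have hkD : k ≤ D := by omega
  -- it suffices to prove the inequality multiplied by `(k!)²·2^k·E^k > 0`
  have hpos : 0 < (k.factorial) ^ 2 * 2 ^ k * E ^ k := by positivity
  refine Nat.le_of_mul_le_mul_left ?_ hpos
  -- left side: `(k!)²·binom(n,k)² = (n^{(k)})² ≤ (n^k)²`
  have hL : (k.factorial) ^ 2 * (n.choose k) ^ 2 ≤ (n ^ k) ^ 2 := by
    rw [← mul_pow, ← Nat.descFactorial_eq_factorial_mul_choose]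
    exact Nat.pow_le_pow_left (Nat.descFactorial_le_pow n k) 2
  -- right side pieces: `k!·binom(D,k) = D^{(k)} ≥ (D+1-k)^k`, and `2(D+1-k) ≥ D`
  have hR : (D + 1 - k) ^ k ≤ k.factorial * D.choose k := by
    rw [← Nat.descFactorial_eq_factorial_mul_choose]; exact Nat.pow_sub_le_descFactorial D k
  have h2 : D ^ k ≤ 2 ^ k * (D + 1 - k) ^ k := by
    rw [← mul_pow]; exact Nat.pow_le_pow_left (by omega) k
  -- `D^k · E^k ≥ (3n²)^k = 3^k (n^k)²`
  have h3 : 3 ^ k * (n ^ k) ^ 2 ≤ D ^ k * E ^ k := by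
    have : 3 ^ k * (n ^ k) ^ 2 = (3 * n ^ 2) ^ k := by
      rw [mul_pow, ← pow_mul, ← pow_mul, mul_comm k 2]
    rw [this, ← mul_pow]
    exact Nat.pow_le_pow_left hwin k
  -- the Taylor bound
  have hT := two_mul_pow_le n E k hn
  -- assemble
  calc (k.factorial) ^ 2 * 2 ^ k * E ^ k * ((n.choose k) ^ 2)
      = (2 * E) ^ k * ((k.factorial) ^ 2 * (n.choose k) ^ 2) := by rw [mul_pow]; ring
    _ ≤ (k.factorial * 3 ^ k * (n + 2) ^ E) * (n ^ k) ^ 2 := Nat.mul_le_mul hT hL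
    _ = k.factorial * (n + 2) ^ E * (3 ^ k * (n ^ k) ^ 2) := by ring
    _ ≤ k.factorial * (n + 2) ^ E * (D ^ k * E ^ k) := Nat.mul_le_mul_left _ h3
    _ ≤ k.factorial * (n + 2) ^ E * ((2 ^ k * (D + 1 - k) ^ k) * E ^ k) := by gcongr
    _ = 2 ^ k * E ^ k * (n + 2) ^ E * (k.factorial * (D + 1 - k) ^ k) := by ring
    _ ≤ 2 ^ k * E ^ k * (n + 2) ^ E * (k.factorial * (k.factorial * D.choose k)) := by gcongr
    _ = (k.factorial) ^ 2 * 2 ^ k * E ^ k * ((n + 2) ^ E * D.choose k) := by ring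

end Summit.ValiantsHypothesis.ValiantsHypothesis.Theorems.SummationBitsDepth3Thesis
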